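/-
Copyright (c) 2026 the pub-hodgecm-mathlib formalisation cell (harness21).  Prover seat hodgecm-mathlib-K2Liu-p01 (g8), Track B «K2-LIT»,
#184♮ = hLiu418 = `stmt-HodgeConjecture-24832`; #42S organ S1 ROAD W, F7 `K2LiuLocalSWParityOscillation` (RULINGS «M-158a» (2), «M-158b» (1)), organ lead K2Liu-p06 (g4)
SPEC-S1-AssemblySocket §2 row `hsum`; my CENSUS-F7-ProfileSumTransport (d5aeea8ad1f9d314) file (T1): the PROFILE SUM over `S₁ ⧸ S₀` by CHARACTER ORTHOGONALITY (generic).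
-/
import Mathlib.MeasureTheory.Integral.Bochner.Basic
import Mathlib.MeasureTheory.Integral.Bochner.Set
import Mathlib.Algebra.Group.AddChar
import Mathlib.GroupTheory.QuotientGroup.Basic
import HarnessLib

/-!
# Crux `HLiu418`, #42S-S1 ROAD W, file (T1): THE PROFILE SUM OVER `S₁ ⧸ S₀` BY CHARACTER ORTHOGONALITY —
# `Σ_{r ∈ S₁⧸S₀} ∫ e(r̃, x)·φ(x) dμ = |S₁⧸S₀| · ∫ 𝟙_D φ dμ`, `D = {x : e(t, x) = 1 for all t ∈ S₁}`

Cell `hodgecm-mathlib`, crux item hLiu418 = `stmt-HodgeConjecture-24832` (helper lane `--supports … --as helper`, count-neutral).  THEOREMS ONLY (no `def`, no instance,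
no notation, no named-fact hypothesis, no `sorry`).  GENERIC (any measure space `X`, any additive group `M`, any `S₀, S₁ ≤ M` with `S₁ ⧸ S₀` finite): serves the inert
(F7), ramified (F7r) and split (F8) witnesses of organ S1 verbatim.

THE SITUATION (★ F3f `K2LiuLocalSWCoordinateQuotient.sum_quotient_eq_sum_skewQuotient` + ★ F4a `K2LiuLocalSWBigCellFormula.…_integral`): the `hsum` binder of the S1 socket is
`Σ_{r ∈ 𝔰_Λ ⧸ 𝔰_{Λ₀}} f₀(w_Δ n(r̃))` with `f₀(w_Δ n(t)) = Σ_ε μ_ε γ′_ε ∫ ψ_v(−½ x ⬝ᵥ c_t x)·(ΓΦ^ε)(x) dμ`, and `t ↦ ψ_v(−½ x ⬝ᵥ c_t x) =: e(t, x)` is a CHARACTER in `t`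
(`x ⬝ᵥ c_{n(t)} x = formD(u, matA(n t) u)` is additive in `t`, ★ `dotProduct_cOfFix_mover_conj`), trivial on `𝔰_{Λ₀}` over the support of `ΓΦ^ε` (the socket's `hf₀inv`).  Then:
* §1 the character `r ↦ e(r̃, x)` on the finite group `S₁ ⧸ S₀` is WELL DEFINED on the support (`apply_out_eq`), an `AddChar` (built inside the proof), and its sum is
  `|S₁⧸S₀|·𝟙[e(·, x) ≡ 1 on S₁]` (**`sum_apply_out_eq_ite`**, Mathlib `AddChar.sum_eq_ite`);
* §2 **`sum_integral_eq_card_mul_integral_indicator`** — summing under the integral: `Σ_r ∫ e(r̃,x)φ(x) dμ = |S₁⧸S₀| · ∫ 𝟙_D(x) φ(x) dμ`, `D = {x : ∀ t ∈ S₁, e(t,x) = 1}`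
  (no measurability of `D` needed in this form); `…_eq_card_mul_setIntegral` — the set-integral form when `D` is measurable; `integrable_mul_of_norm_le_one` — the integrability
  input from `Integrable φ` and `‖e(t,x)‖ ≤ 1`.
[Tate1950, §2.2 (orthogonality over compact∕discrete pairs)] [Weil1964, n° 13–14] [KudlaRallis1994, §2 (local densities as limits of character sums)].
HONEST LABEL.  Count-neutral helper; `HC_CM` is proved only modulo the 7 printed citations (2 remaining named inputs: hLiu418 = `stmt-HodgeConjecture-24832`,
h413 = `stmt-HodgeConjecture-24833`) until rung 0 closes.  NOT here: the cell-volume count of `∫ 𝟙_D φ` ((T2)), the frame identification ((T3)), the assembly ((T4)).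

## References
* [Tate1950] J. Tate, *Fourier analysis in number fields and Hecke's zeta-functions* (1950), §2.2.
* [Weil1964] A. Weil, *Sur certains groupes d'opérateurs unitaires*, Acta Math. 111 (1964), n° 13–14.
* [KudlaRallis1994] S. Kudla, S. Rallis, Ann. of Math. 140 (1994), §2.
-/

set_option autoImplicit false
set_option linter.dupNamespace false -- the mandated namespace repeats `HodgeConjecture.HodgeConjecture`

open MeasureTheory Finset
open scoped Classical

namespace Summit.HodgeConjecture.HodgeConjecture.Cruxes.HLiu418.K2LiuProfileSumCharacterOrthogonality

variable {X : Type*} {M : Type*} [AddCommGroup M] {S₀ S₁ : AddSubgroup M}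

/-! ## §1 The character on `S₁ ⧸ S₀` attached to a point of the support -/

/-- **well-definedness**: if `e(·, x)` is multiplicative on `S₁` and trivial on `S₀`, it is constant on `S₀`-cosets: `t − t′ ∈ S₀ ⇒ e(t, x) = e(t′, x)`.
[cite: Tate1950, §2.2] -/
theorem apply_eq_of_sub_mem (e : M → X → ℂ) (x : X) (hadd : ∀ t ∈ S₁, ∀ t' ∈ S₁, e (t + t') x = e t x * e t' x) (h0 : ∀ t ∈ S₀, t ∈ S₁ → e t x = 1)
    {t t' : M} (ht : t ∈ S₁) (ht' : t' ∈ S₁) (h : t - t' ∈ S₀) : e t x = e t' x := by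
  have e1 : t = t' + (t - t') := by abel
  have hsub : t - t' ∈ S₁ := S₁.sub_mem ht ht'
  rw [e1, hadd t' ht' (t - t') hsub, h0 _ h hsub, mul_one]

/-- the chosen representative of the class of `s ∈ S₁` gives the same value: `e((mk s).out, x) = e(s, x)`. [cite: Tate1950, §2.2] -/
theorem apply_out_mk_eq (e : M → X → ℂ) (x : X) (hadd : ∀ t ∈ S₁, ∀ t' ∈ S₁, e (t + t') x = e t x * e t' x) (h0 : ∀ t ∈ S₀, t ∈ S₁ → e t x = 1) (s : S₁) :
    e ((QuotientAddGroup.mk s : S₁ ⧸ S₀.addSubgroupOf S₁).out : M) x = e (s : M) x := by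
  refine apply_eq_of_sub_mem e x hadd h0 (Subtype.coe_prop _) s.2 ?_
  have h := (QuotientAddGroup.mk s : S₁ ⧸ S₀.addSubgroupOf S₁).out_eq'
  rw [QuotientAddGroup.eq] at h
  -- `h : -(out) + s ∈ S₀.addSubgroupOf S₁`
  have h' : (s : M) - ((QuotientAddGroup.mk s : S₁ ⧸ S₀.addSubgroupOf S₁).out : M) ∈ S₀ := by
    have := AddSubgroup.mem_addSubgroupOf.1 h
    rw [AddSubgroup.coe_add, AddSubgroup.coe_neg, neg_add_eq_sub] at this
    exact this
  rw [← neg_sub]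
  exact S₀.neg_mem h'

/-- **ORTHOGONALITY**: `Σ_{r ∈ S₁⧸S₀} e(r̃, x) = |S₁⧸S₀|` if `e(·, x) ≡ 1` on `S₁`, and `= 0` otherwise (`r ↦ e(r̃, x)` is an additive character of the finite group `S₁ ⧸ S₀`;
Mathlib `AddChar.sum_eq_ite`). [cite: Tate1950, §2.2] [cite: Weil1964, n° 13] -/
theorem sum_apply_out_eq_ite [Fintype (S₁ ⧸ S₀.addSubgroupOf S₁)] (e : M → X → ℂ) (x : X)
    (hadd : ∀ t ∈ S₁, ∀ t' ∈ S₁, e (t + t') x = e t x * e t' x) (h0 : ∀ t ∈ S₀, t ∈ S₁ → e t x = 1) :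
    ∑ r : S₁ ⧸ S₀.addSubgroupOf S₁, e (r.out : M) x = if ∀ t ∈ S₁, e t x = 1 then (Fintype.card (S₁ ⧸ S₀.addSubgroupOf S₁) : ℂ) else 0 := by
  -- `e(0, x) = 1` (from `0 ∈ S₀`)
  have he0 : e 0 x = 1 := h0 0 S₀.zero_mem S₁.zero_mem
  -- the character
  let χ : AddChar (S₁ ⧸ S₀.addSubgroupOf S₁) ℂ :=
    { toFun := fun r => e (r.out : M) x
      map_zero_eq_one' := by
        have h := apply_out_mk_eq e x hadd h0 (0 : S₁)
        rw [QuotientAddGroup.mk_zero] at h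
        rw [h, AddSubgroup.coe_zero, he0]
      map_add_eq_mul' := fun a b => by
        obtain ⟨a, rfl⟩ := QuotientAddGroup.mk_surjective a
        obtain ⟨b, rfl⟩ := QuotientAddGroup.mk_surjective b
        rw [← QuotientAddGroup.mk_add, apply_out_mk_eq e x hadd h0, apply_out_mk_eq e x hadd h0, apply_out_mk_eq e x hadd h0, AddSubgroup.coe_add,
          hadd _ a.2 _ b.2] }
  have hχ : ∀ r, χ r = e (r.out : M) x := fun r => rfl
  have hsum := AddChar.sum_eq_ite χ
  simp only [hχ] at hsum
  rw [hsum]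
  -- `χ = 0 ↔ e(·, x) ≡ 1 on S₁`
  congr 1
  refine propext ⟨fun h t ht => ?_, fun h => ?_⟩
  · have h1 : χ (QuotientAddGroup.mk ⟨t, ht⟩) = 1 := by rw [h, AddChar.zero_apply]
    rw [hχ, apply_out_mk_eq e x hadd h0] at h1
    exact h1
  · ext r
    rw [hχ, AddChar.zero_apply]
    exact h _ (r.out).2

/-! ## §2 Summing under the integral -/

/-- pointwise: `(Σ_r e(r̃, x))·φ(x) = |S₁⧸S₀| · 𝟙_D(x)·φ(x)` where `D = {x : ∀ t ∈ S₁, e(t, x) = 1}` — at points with `φ x = 0` both sides vanish, elsewhere §1 applies.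
[cite: Tate1950, §2.2] -/
theorem sum_apply_out_mul_eq [Fintype (S₁ ⧸ S₀.addSubgroupOf S₁)] (e : M → X → ℂ) (φ : X → ℂ)
    (hadd : ∀ x, φ x ≠ 0 → ∀ t ∈ S₁, ∀ t' ∈ S₁, e (t + t') x = e t x * e t' x) (h0 : ∀ x, φ x ≠ 0 → ∀ t ∈ S₀, t ∈ S₁ → e t x = 1) (x : X) :
    (∑ r : S₁ ⧸ S₀.addSubgroupOf S₁, e (r.out : M) x) * φ x =
      (Fintype.card (S₁ ⧸ S₀.addSubgroupOf S₁) : ℂ) * Set.indicator {x | ∀ t ∈ S₁, e t x = 1} φ x := by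
  by_cases hφ : φ x = 0
  · rw [hφ, mul_zero, Set.indicator_apply_eq_zero.2 (fun _ => hφ), mul_zero]
  · rw [sum_apply_out_eq_ite e x (hadd x hφ) (h0 x hφ)]
    by_cases hD : ∀ t ∈ S₁, e t x = 1
    · rw [if_pos hD, Set.indicator_of_mem (show x ∈ {x | ∀ t ∈ S₁, e t x = 1} from hD)]
    · rw [if_neg hD, Set.indicator_of_notMem (show x ∉ {x | ∀ t ∈ S₁, e t x = 1} from hD), zero_mul, mul_zero]

variable [MeasurableSpace X]

/-- **THE PROFILE SUM BY ORTHOGONALITY.**  For `e : M → X → ℂ` multiplicative in `t ∈ S₁` and trivial for `t ∈ S₀` at every point of the support of `φ`, and `e(t,·)·φ` integrable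
for `t ∈ S₁`: `Σ_{r ∈ S₁⧸S₀} ∫ e(r̃, x)·φ(x) dμ = |S₁⧸S₀| · ∫ 𝟙_D(x)·φ(x) dμ`, `D = {x : ∀ t ∈ S₁, e(t, x) = 1}`. [cite: Tate1950, §2.2] [cite: KudlaRallis1994, §2] -/
theorem sum_integral_eq_card_mul_integral_indicator [Fintype (S₁ ⧸ S₀.addSubgroupOf S₁)] (μ : Measure X) (e : M → X → ℂ) (φ : X → ℂ)
    (hadd : ∀ x, φ x ≠ 0 → ∀ t ∈ S₁, ∀ t' ∈ S₁, e (t + t') x = e t x * e t' x) (h0 : ∀ x, φ x ≠ 0 → ∀ t ∈ S₀, t ∈ S₁ → e t x = 1)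
    (hint : ∀ t ∈ S₁, Integrable (fun x => e t x * φ x) μ) :
    ∑ r : S₁ ⧸ S₀.addSubgroupOf S₁, ∫ x, e (r.out : M) x * φ x ∂μ =
      (Fintype.card (S₁ ⧸ S₀.addSubgroupOf S₁) : ℂ) * ∫ x, Set.indicator {x | ∀ t ∈ S₁, e t x = 1} φ x ∂μ := by
  rw [← integral_finsetSum _ (fun r _ => hint _ (r.out).2), ← integral_const_mul]
  refine integral_congr_ae (Filter.Eventually.of_forall fun x => ?_)
  change ∑ r : S₁ ⧸ S₀.addSubgroupOf S₁, e (r.out : M) x * φ x = (Fintype.card (S₁ ⧸ S₀.addSubgroupOf S₁) : ℂ) * Set.indicator {x | ∀ t ∈ S₁, e t x = 1} φ x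
  rw [← sum_mul, sum_apply_out_mul_eq e φ hadd h0 x]

/-- **… SET-INTEGRAL FORM** when `D = {x : ∀ t ∈ S₁, e(t, x) = 1}` is measurable: `Σ_r ∫ e(r̃, x)φ(x) dμ = |S₁⧸S₀| · ∫_{D} φ dμ`. [cite: Tate1950, §2.2] [cite: KudlaRallis1994, §2] -/
theorem sum_integral_eq_card_mul_setIntegral [Fintype (S₁ ⧸ S₀.addSubgroupOf S₁)] (μ : Measure X) (e : M → X → ℂ) (φ : X → ℂ)
    (hadd : ∀ x, φ x ≠ 0 → ∀ t ∈ S₁, ∀ t' ∈ S₁, e (t + t') x = e t x * e t' x) (h0 : ∀ x, φ x ≠ 0 → ∀ t ∈ S₀, t ∈ S₁ → e t x = 1)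
    (hint : ∀ t ∈ S₁, Integrable (fun x => e t x * φ x) μ) (hD : MeasurableSet {x | ∀ t ∈ S₁, e t x = 1}) :
    ∑ r : S₁ ⧸ S₀.addSubgroupOf S₁, ∫ x, e (r.out : M) x * φ x ∂μ =
      (Fintype.card (S₁ ⧸ S₀.addSubgroupOf S₁) : ℂ) * ∫ x in {x | ∀ t ∈ S₁, e t x = 1}, φ x ∂μ := by
  rw [sum_integral_eq_card_mul_integral_indicator μ e φ hadd h0 hint, integral_indicator hD]

omit [AddCommGroup M] in
/-- the integrability input from `Integrable φ` and a unimodular bound `‖e(t, x)‖ ≤ 1` (values of a unitary character), `e(t, ·)` a.e.-strongly measurable. [folklore] -/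
theorem integrable_mul_of_norm_le_one (μ : Measure X) (e : M → X → ℂ) (φ : X → ℂ) (hφ : Integrable φ μ) {t : M}
    (hmeas : AEStronglyMeasurable (e t) μ) (hbound : ∀ x, ‖e t x‖ ≤ 1) : Integrable (fun x => e t x * φ x) μ :=
  hφ.bdd_mul hmeas (Filter.Eventually.of_forall hbound)

/-- **THE SUPPORT FORM** (the organ's currency: the conditions are imposed on `tsupport φ ⊆ K`, e.g. `K` = the lattice box of the witness): same conclusion.
[cite: Tate1950, §2.2] [cite: KudlaRallis1994, §2] -/
theorem sum_integral_eq_card_mul_integral_indicator_of_subset [Fintype (S₁ ⧸ S₀.addSubgroupOf S₁)] (μ : Measure X) (e : M → X → ℂ) (φ : X → ℂ) {K : Set X}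
    (hK : Function.support φ ⊆ K)
    (hadd : ∀ x ∈ K, ∀ t ∈ S₁, ∀ t' ∈ S₁, e (t + t') x = e t x * e t' x) (h0 : ∀ x ∈ K, ∀ t ∈ S₀, t ∈ S₁ → e t x = 1)
    (hint : ∀ t ∈ S₁, Integrable (fun x => e t x * φ x) μ) :
    ∑ r : S₁ ⧸ S₀.addSubgroupOf S₁, ∫ x, e (r.out : M) x * φ x ∂μ =
      (Fintype.card (S₁ ⧸ S₀.addSubgroupOf S₁) : ℂ) * ∫ x, Set.indicator {x | ∀ t ∈ S₁, e t x = 1} φ x ∂μ :=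
  sum_integral_eq_card_mul_integral_indicator μ e φ (fun x hx => hadd x (hK (Function.mem_support.2 hx))) (fun x hx => h0 x (hK (Function.mem_support.2 hx))) hint

end Summit.HodgeConjecture.HodgeConjecture.Cruxes.HLiu418.K2LiuProfileSumCharacterOrthogonality
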